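import Mathlib.NumberTheory.Real.Irrational
import Mathlib.Analysis.SpecialFunctions.Exp
import Mathlib.Analysis.Complex.Exponential
import Literature.NumberTheory.Transcendental.ZetaLinearFormsCriterion
import Literature.NumberTheory.Transcendental.PeriodsWave0
import HarnessLib

/-!
# ζ(5) search — the typed irrationality criteria (cell `pub-zeta5`, TYPER)

HONEST FRAMING: systematic search; no irrationality claim unless certified.

This file is the Lean side of the cell's `CRITERIA.md`: the EXACT certificate a searched
Apéry-type construction (Brown's cellular integrals on `M_{0,n}`, Beukers/Rhin–Viola/Sorokin
integrals, Ball–Rivoal/Zudilin very-well-poised hypergeometric families, creative-telescoping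
recurrences) must meet before any irrationality claim for `ξ = ζ(5)`
(`Literature.NumberTheory.Transcendental.zetaValue 5`, open problem
`Literature.NumberTheory.Transcendental.ZetaFiveIrrational`) or for Catalan's constant
(`…catalanConstant`, open problem `…CatalanIrrational`). Everything here is PROVED; there is no
named fact and no `sorry`. Nothing in this file claims either open problem: the theorems are
implications `certificate ⇒ irrational`, and no certificate is constructed.

## Contents

* `irrational_of_int_linear_forms` — **the elementary criterion for one number**: integer
  sequences `a n, b n` with `a n + b n ξ → 0` and `a n + b n ξ ≠ 0` infinitely often force
  `ξ ∉ ℚ`. Deduced from the tree's `ι`-indexed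
  `Literature.NumberTheory.Transcendental.exists_irrational_of_integerLinearForms`
  (Fischler, Sém. Bourbaki 910, §1; Zudilin 2004, §8) at `ι = Fin 1`.
* `irrational_of_linear_forms` — the same in the form "`0 < |q n ξ - p n| → 0`".
* `irrational_of_scaled_linear_forms` — the working form with DENOMINATORS and SAVINGS: raw forms
  `ℓ n` (an integral, a hypergeometric sum) with `D n · ℓ n = Φ n · (a n + b n ξ)`, `a n, b n ∈ ℤ`,
  `D n ∈ ℕ⁺` the common denominator (`d_n^k`-type products of `lcm(1..m)`), `Φ n ∈ ℕ⁺` an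
  arithmetic correction (`p`-adic cancellations à la Rhin–Viola / Zudilin; `Φ = 1` if none), and
  `D n ℓ n / Φ n → 0`.
* `LinearFormCertificate ξ` — the certificate as a structure with EXPONENTS: decay rate `c`
  (`|ℓ n| ≤ e^{-c n}`), denominator rate `δ` (`D n ≤ e^{δ n}`), savings rate `φ`
  (`e^{φ n} ≤ Φ n`), all for large `n`, non-vanishing for infinitely many `n`, and the MARGIN
  inequality `δ < c + φ`; `LinearFormCertificate.irrational : Irrational ξ`. The margin
  `c + φ - δ` is `LinearFormCertificate.margin`; it is the number `NEAR-MISSES.md` ranks by.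
* `eventually_prod_lcmUpto_pow_le_exp` — growth of the standard denominators
  `∏ᵢ lcm(1..cᵢ n)^{kᵢ} ≤ e^{(∑ cᵢ kᵢ + ε) n}` for large `n`, from the PRIME NUMBER THEOREM as
  proved in the tree (`Literature.NumberTheory.Transcendental.eventually_lcmUpto_mul_pow_le_exp`,
  resting on `Literature.NumberTheory.LFunctions.chebyshevPsi_isEquivalent_holds`); hence
  `irrational_of_lcm_linear_forms`, the certificate with `D n = ∏ᵢ d_{cᵢ n}^{kᵢ}` and
  `δ = ∑ cᵢ kᵢ` — no PNT hypothesis is left open.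
* `zetaFiveIrrational_of_certificate`, `catalanIrrational_of_certificate` — the instantiations:
  a certificate for `zetaValue 5` (resp. `catalanConstant`) proves the tree's open statement
  `ZetaFiveIrrational` (resp. `CatalanIrrational`).

The quantitative criterion of Nesterenko (1985) for forms in SEVERAL numbers (e.g. in
`1, ζ(3), ζ(5)`) is already PROVED in the tree as
`Literature.NumberTheory.DiophantineApproximation.NesterenkoCriterion.nesterenko_criterion`; its
three-term corollary for this search is in the sibling file `CriteriaNesterenko.lean`.

## Design notes

* Rates are stated with FIXED exponents and `∀ᶠ n : ℕ in atTop` (the user of a certificate picks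
  rational `c, δ, φ` a little inside the true `limsup/liminf` rates; the slack is part of the
  margin bookkeeping of `CRITERIA.md`). This is exactly the shape in which the tree glues
  Zudilin's theorem (`Literature.NumberTheory.Transcendental.Zudilin2004.zudilin_of_linearForms`).
* The arithmetic identity `D n ℓ n = Φ n (a n + b n ξ)` is only required for large `n`
  (`∀ᶠ`), so shifted or finitely-perturbed families need no re-indexing.
* No closed `Prop` definitions: the open problems are the tree's
  `ZetaFiveIrrational` / `CatalanIrrational`, used by name.
-/

noncomputable section

open Filter Topology Finset
open Literature.NumberTheory.Transcendental

namespace Summit.KontsevichZagierPeriods.Zeta5Search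

/-! ### The elementary criterion for one number -/

/-- **Elementary irrationality criterion, one number.** If `a n + b n · ξ → 0` for integer
sequences `a, b` and `a n + b n · ξ ≠ 0` for infinitely many `n`, then `ξ` is irrational.
(If `ξ = p/q` then `q (a n + b n ξ)` is a sequence of integers tending to `0`, hence eventually
`0`.) The case `ι = Fin 1` of
`Literature.NumberTheory.Transcendental.exists_irrational_of_integerLinearForms`. -/
theorem irrational_of_int_linear_forms {ξ : ℝ} (a b : ℕ → ℤ)
    (hsmall : Tendsto (fun n => (a n : ℝ) + b n * ξ) atTop (𝓝 0))
    (hne : ∃ᶠ n : ℕ in atTop, (a n : ℝ) + b n * ξ ≠ 0) : Irrational ξ := by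
  obtain ⟨_, h⟩ := exists_irrational_of_integerLinearForms (ι := Fin 1) (fun _ => ξ)
    (fun n => (a n : ℝ) + b n * ξ) a (fun n _ => b n)
    (fun n => by simp) hsmall hne
  exact h

/-- **Elementary irrationality criterion, `|q ξ - p|` form.** If there are integer sequences
`p n, q n` with `0 < |q n ξ - p n|` for every `n` and `|q n ξ - p n| → 0`, then `ξ ∉ ℚ`. -/
theorem irrational_of_linear_forms {ξ : ℝ} (p q : ℕ → ℤ)
    (hpos : ∀ n, 0 < |(q n : ℝ) * ξ - p n|)
    (hlim : Tendsto (fun n => |(q n : ℝ) * ξ - p n|) atTop (𝓝 0)) : Irrational ξ := by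
  refine irrational_of_int_linear_forms (fun n => -p n) q ?_ ?_
  · have h : Tendsto (fun n => (q n : ℝ) * ξ - p n) atTop (𝓝 0) :=
      squeeze_zero_norm' (Eventually.of_forall fun n => by
        rw [Real.norm_eq_abs]) hlim
    refine h.congr fun n => ?_
    push_cast
    ring
  · refine Eventually.frequently (Eventually.of_forall fun n => ?_)
    have h := (hpos n).ne'
    rw [abs_ne_zero] at h
    intro h'
    apply h
    push_cast at h'
    linarith

/-- **Elementary criterion, frequently-nonzero form.** Integer sequences `p n, q n` with
`q n ξ - p n → 0` and `q n ξ ≠ p n` for infinitely many `n` force `ξ ∉ ℚ`. -/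
theorem irrational_of_linear_forms' {ξ : ℝ} (p q : ℕ → ℤ)
    (hne : ∃ᶠ n : ℕ in atTop, (q n : ℝ) * ξ ≠ p n)
    (hlim : Tendsto (fun n => (q n : ℝ) * ξ - p n) atTop (𝓝 0)) : Irrational ξ := by
  refine irrational_of_int_linear_forms (fun n => -p n) q ?_ ?_
  · refine hlim.congr fun n => ?_
    push_cast
    ring
  · refine hne.mono fun n h h' => h ?_
    push_cast at h'
    linarith

/-! ### Denominators and arithmetic savings -/

/-- **Criterion with denominators and savings.** Let `ℓ n` be real "raw" linear forms such that,
for all large `n`, `D n · ℓ n = Φ n · (a n + b n ξ)` with integers `a n, b n`, positive natural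
denominators `D n` and positive natural savings factors `Φ n`. If `D n ℓ n / Φ n → 0` and
`ℓ n ≠ 0` for infinitely many `n`, then `ξ` is irrational. -/
theorem irrational_of_scaled_linear_forms {ξ : ℝ} (ℓ : ℕ → ℝ) (D Φ : ℕ → ℕ) (a b : ℕ → ℤ)
    (hD : ∀ n, 0 < D n) (hΦ : ∀ n, 0 < Φ n)
    (harith : ∀ᶠ n : ℕ in atTop, (D n : ℝ) * ℓ n = Φ n * (a n + b n * ξ))
    (hsmall : Tendsto (fun n => (D n : ℝ) * ℓ n / Φ n) atTop (𝓝 0))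
    (hne : ∃ᶠ n : ℕ in atTop, ℓ n ≠ 0) : Irrational ξ := by
  have hΦ' : ∀ n, (Φ n : ℝ) ≠ 0 := fun n => by exact_mod_cast (hΦ n).ne'
  have hD' : ∀ n, (D n : ℝ) ≠ 0 := fun n => by exact_mod_cast (hD n).ne'
  have heq : ∀ᶠ n : ℕ in atTop, (D n : ℝ) * ℓ n / Φ n = (a n : ℝ) + b n * ξ := by
    filter_upwards [harith] with n hn
    rw [hn, mul_div_cancel_left₀ _ (hΦ' n)]
  refine irrational_of_int_linear_forms a b (hsmall.congr' heq) ?_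
  refine (hne.and_eventually heq).mono fun n hn => ?_
  rw [← hn.2]
  exact div_ne_zero (mul_ne_zero (hD' n) hn.1) (hΦ' n)

/-! ### The certificate with exponents -/

/-- **Irrationality certificate for a real number `ξ`** — the exact data a candidate family of
the search must deliver (cell `CRITERIA.md`, criterion C1):
* `form n` — the raw linear forms `ℓ n` (value of the integral / hypergeometric series);
* `denom n = D n > 0` — the common denominator (a product of powers of `lcm(1..m)`);
* `saving n = Φ n > 0` — the arithmetic correction dividing all coefficients (`1` if none);
* `coeffConst n = a n`, `coeffXi n = b n` — the integers with `D n ℓ n = Φ n (a n + b n ξ)` for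
  large `n` (`arith`);
* `decayRate = c`, `denomRate = δ`, `savingRate = φ` with, for large `n`,
  `|ℓ n| ≤ e^{-c n}` (`decay`), `D n ≤ e^{δ n}` (`denom_le`), `e^{φ n} ≤ Φ n` (`le_saving`);
* `nonvanishing` — `ℓ n ≠ 0` for infinitely many `n`;
* `margin_pos` — the MARGIN inequality `δ < c + φ`.
Then `ξ` is irrational (`LinearFormCertificate.irrational`). -/
structure LinearFormCertificate (ξ : ℝ) where
  /-- the raw linear forms `ℓ n` -/
  form : ℕ → ℝ
  /-- the common denominators `D n` -/
  denom : ℕ → ℕ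
  /-- the arithmetic savings factors `Φ n` -/
  saving : ℕ → ℕ
  /-- the integer constant coefficients `a n` -/
  coeffConst : ℕ → ℤ
  /-- the integer coefficients `b n` of `ξ` -/
  coeffXi : ℕ → ℤ
  /-- the decay exponent `c`: `|ℓ n| ≤ e^{-c n}` for large `n` -/
  decayRate : ℝ
  /-- the denominator exponent `δ`: `D n ≤ e^{δ n}` for large `n` -/
  denomRate : ℝ
  /-- the savings exponent `φ`: `e^{φ n} ≤ Φ n` for large `n` -/
  savingRate : ℝ
  /-- `D n > 0` -/
  denom_pos : ∀ n, 0 < denom n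
  /-- `Φ n > 0` -/
  saving_pos : ∀ n, 0 < saving n
  /-- the arithmetic of the forms: `D n ℓ n = Φ n (a n + b n ξ)` for large `n` -/
  arith : ∀ᶠ n : ℕ in atTop,
    (denom n : ℝ) * form n = saving n * (coeffConst n + coeffXi n * ξ)
  /-- decay: `|ℓ n| ≤ e^{-c n}` for large `n` -/
  decay : ∀ᶠ n : ℕ in atTop, |form n| ≤ Real.exp (-(decayRate * n))
  /-- denominator growth: `D n ≤ e^{δ n}` for large `n` -/
  denom_le : ∀ᶠ n : ℕ in atTop, (denom n : ℝ) ≤ Real.exp (denomRate * n)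
  /-- savings growth: `e^{φ n} ≤ Φ n` for large `n` -/
  le_saving : ∀ᶠ n : ℕ in atTop, Real.exp (savingRate * n) ≤ saving n
  /-- non-vanishing: `ℓ n ≠ 0` for infinitely many `n` -/
  nonvanishing : ∃ᶠ n : ℕ in atTop, form n ≠ 0
  /-- the margin inequality `δ < c + φ` -/
  margin_pos : denomRate < decayRate + savingRate

namespace LinearFormCertificate

variable {ξ : ℝ}

/-- The MARGIN `c + φ - δ` of a certificate (positive by `margin_pos`): the exponential rate at
which the scaled integer forms `D n ℓ n / Φ n` still tend to `0`. -/
def margin (cert : LinearFormCertificate ξ) : ℝ := cert.decayRate + cert.savingRate - cert.denomRate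

/-- The margin of a certificate is positive. -/
theorem margin_pos' (cert : LinearFormCertificate ξ) : 0 < cert.margin := by
  have := cert.margin_pos
  unfold margin
  linarith

/-- The scaled forms of a certificate decay at the margin rate:
`|D n ℓ n / Φ n| ≤ e^{-(c + φ - δ) n}` for all large `n`. -/
theorem eventually_abs_scaled_le (cert : LinearFormCertificate ξ) :
    ∀ᶠ n : ℕ in atTop, |(cert.denom n : ℝ) * cert.form n / cert.saving n| ≤
      Real.exp (-(cert.margin * n)) := by
  filter_upwards [cert.decay, cert.denom_le, cert.le_saving] with n hdec hden hsav
  have hΦ : (0 : ℝ) < cert.saving n := by exact_mod_cast cert.saving_pos n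
  have hD : (0 : ℝ) ≤ cert.denom n := by positivity
  rw [abs_div, abs_of_pos hΦ, div_le_iff₀ hΦ, abs_mul, abs_of_nonneg hD]
  calc (cert.denom n : ℝ) * |cert.form n|
      ≤ Real.exp (cert.denomRate * n) * Real.exp (-(cert.decayRate * n)) :=
        mul_le_mul hden hdec (abs_nonneg _) (Real.exp_pos _).le
    _ = Real.exp (-(cert.margin * n)) * Real.exp (cert.savingRate * n) := by
        rw [← Real.exp_add, ← Real.exp_add]
        congr 1
        simp only [margin]
        ring
    _ ≤ Real.exp (-(cert.margin * n)) * cert.saving n :=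
        mul_le_mul_of_nonneg_left hsav (Real.exp_pos _).le

/-- The scaled forms `D n ℓ n / Φ n` of a certificate tend to `0`. -/
theorem tendsto_scaled (cert : LinearFormCertificate ξ) :
    Tendsto (fun n : ℕ => (cert.denom n : ℝ) * cert.form n / cert.saving n) atTop (𝓝 0) := by
  have hm := cert.margin_pos'
  have h0 : Tendsto (fun n : ℕ => Real.exp (-(cert.margin * n))) atTop (𝓝 0) := by
    refine Real.tendsto_exp_atBot.comp ?_
    have h1 : Tendsto (fun n : ℕ => cert.margin * (n : ℝ)) atTop atTop :=
      (tendsto_natCast_atTop_atTop).const_mul_atTop hm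
    show Tendsto (fun n : ℕ => -(cert.margin * (n : ℝ))) atTop atBot
    exact tendsto_neg_atTop_atBot.comp h1
  refine squeeze_zero_norm' ?_ h0
  filter_upwards [cert.eventually_abs_scaled_le] with n hn
  rw [Real.norm_eq_abs]
  exact hn

/-- **Certificate ⇒ irrational.** A `LinearFormCertificate ξ` proves `Irrational ξ`. -/
theorem irrational (cert : LinearFormCertificate ξ) : Irrational ξ :=
  irrational_of_scaled_linear_forms cert.form cert.denom cert.saving cert.coeffConst cert.coeffXi
    cert.denom_pos cert.saving_pos cert.arith cert.tendsto_scaled cert.nonvanishing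

end LinearFormCertificate

/-! ### Denominators `∏ᵢ lcm(1..cᵢ n)^{kᵢ}` and the prime number theorem -/

/-- **Growth of the standard denominators.** For natural numbers `cᵢ, kᵢ` (`i < m`) and every
`ε > 0`: `∏ᵢ lcm(1, …, cᵢ n)^{kᵢ} ≤ exp((∑ᵢ cᵢ kᵢ + ε) n)` for all large `n` — the prime number
theorem `log lcm(1..N) ~ N` (tree: `Literature.NumberTheory.Transcendental.tendsto_log_lcmUpto_div`,
one factor at a time by `…eventually_lcmUpto_mul_pow_le_exp`). -/
theorem eventually_prod_lcmUpto_pow_le_exp {m : ℕ} (c k : Fin m → ℕ) {ε : ℝ} (hε : 0 < ε) :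
    ∀ᶠ n : ℕ in atTop, (∏ i, ((Nat.lcmUpto (c i * n) : ℝ)) ^ (k i)) ≤
      Real.exp (((∑ i, ((c i * k i : ℕ) : ℝ)) + ε) * n) := by
  rcases Nat.eq_zero_or_pos m with rfl | hm
  · filter_upwards with n
    simp only [univ_eq_empty, prod_empty, sum_empty, zero_add]
    exact Real.one_le_exp (by positivity)
  · have hε' : 0 < ε / m := div_pos hε (by exact_mod_cast hm)
    have hall : ∀ᶠ n : ℕ in atTop, ∀ i, ((Nat.lcmUpto (c i * n) : ℝ)) ^ (k i) ≤
        Real.exp ((c i * k i + ε / m) * n) :=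
      eventually_all.2 fun i => eventually_lcmUpto_mul_pow_le_exp (c i) (k i) hε'
    filter_upwards [hall] with n hn
    calc (∏ i, ((Nat.lcmUpto (c i * n) : ℝ)) ^ (k i))
        ≤ ∏ i, Real.exp ((c i * k i + ε / m) * n) :=
          prod_le_prod (fun _ _ => by positivity) fun i _ => hn i
      _ = Real.exp (∑ i, ((c i : ℝ) * k i + ε / m) * n) := (Real.exp_sum _ _).symm
      _ = Real.exp (((∑ i, ((c i * k i : ℕ) : ℝ)) + ε) * n) := by
          congr 1
          have hm0 : (m : ℝ) ≠ 0 := by exact_mod_cast hm.ne'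
          rw [← sum_mul, sum_add_distrib, sum_const, card_univ, Fintype.card_fin, nsmul_eq_mul,
            mul_div_cancel₀ _ hm0]
          push_cast
          ring

/-- The standard denominators are positive: `0 < ∏ᵢ lcm(1..cᵢ n)^{kᵢ}`. -/
theorem prod_lcmUpto_pow_pos {m : ℕ} (c k : Fin m → ℕ) (n : ℕ) :
    0 < ∏ i, (Nat.lcmUpto (c i * n)) ^ (k i) :=
  prod_pos fun _ _ => pow_pos (Nat.lcmUpto_pos _) _

/-- **Criterion with `lcm` denominators (PNT discharged).** Raw forms `ℓ n` with
`(∏ᵢ d_{cᵢ n}^{kᵢ}) ℓ n = Φ n (a n + b n ξ)` for large `n` (`d_m = lcm(1..m)`, `a n, b n ∈ ℤ`,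
`Φ n ∈ ℕ⁺`), decay `|ℓ n| ≤ e^{-c n}` and savings `e^{φ n} ≤ Φ n` for large `n`, `ℓ n ≠ 0`
infinitely often, and the margin inequality `∑ᵢ cᵢ kᵢ < c + φ`, prove `ξ ∉ ℚ`. The denominator
rate `δ = ∑ᵢ cᵢ kᵢ` comes from the prime number theorem proved in the tree; no hypothesis on primes
remains. -/
theorem irrational_of_lcm_linear_forms {ξ : ℝ} (ℓ : ℕ → ℝ) {m : ℕ} (c k : Fin m → ℕ)
    (Φ : ℕ → ℕ) (a b : ℕ → ℤ) (decayRate savingRate : ℝ) (hΦ : ∀ n, 0 < Φ n)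
    (harith : ∀ᶠ n : ℕ in atTop,
      (∏ i, ((Nat.lcmUpto (c i * n) : ℝ)) ^ (k i)) * ℓ n = Φ n * (a n + b n * ξ))
    (hdecay : ∀ᶠ n : ℕ in atTop, |ℓ n| ≤ Real.exp (-(decayRate * n)))
    (hsaving : ∀ᶠ n : ℕ in atTop, Real.exp (savingRate * n) ≤ Φ n)
    (hne : ∃ᶠ n : ℕ in atTop, ℓ n ≠ 0)
    (hmargin : (∑ i, ((c i * k i : ℕ) : ℝ)) < decayRate + savingRate) : Irrational ξ := by
  set ε : ℝ := (decayRate + savingRate - ∑ i, ((c i * k i : ℕ) : ℝ)) / 2 with hε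
  have hε0 : 0 < ε := by rw [hε]; linarith
  exact LinearFormCertificate.irrational (ξ := ξ)
    { form := ℓ
      denom := fun n => ∏ i, (Nat.lcmUpto (c i * n)) ^ (k i)
      saving := Φ
      coeffConst := a
      coeffXi := b
      decayRate := decayRate
      denomRate := (∑ i, ((c i * k i : ℕ) : ℝ)) + ε
      savingRate := savingRate
      denom_pos := prod_lcmUpto_pow_pos c k
      saving_pos := hΦ
      arith := by
        filter_upwards [harith] with n hn
        push_cast
        exact hn
      decay := hdecay
      denom_le := by
        filter_upwards [eventually_prod_lcmUpto_pow_le_exp c k hε0] with n hn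
        exact_mod_cast hn
      le_saving := hsaving
      nonvanishing := hne
      margin_pos := by rw [hε]; linarith }

/-! ### The two targets of the cell -/

/-- **`ζ(5)`**: a `LinearFormCertificate` for `ζ(5) = zetaValue 5` proves the open statement
`ZetaFiveIrrational` of the tree. (No such certificate is constructed anywhere in the tree; this
is the implication the search computes margins against.) -/
theorem zetaFiveIrrational_of_certificate (cert : LinearFormCertificate (zetaValue 5)) :
    ZetaFiveIrrational :=
  cert.irrational

/-- **Catalan's constant**: a `LinearFormCertificate` for `G = catalanConstant` proves the open
statement `CatalanIrrational` of the tree. -/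
theorem catalanIrrational_of_certificate (cert : LinearFormCertificate catalanConstant) :
    CatalanIrrational :=
  cert.irrational

/-! ### From RATES to certificates
The search reports rates (`|ℓ n|^{1/n} → α`, `log D n / n → δ₀`, `log Φ n / n → φ₀`); the glue
below turns them into the eventual bounds of a certificate, and `irrational_of_rates` is C1 on
rates (margin `δ₀ + log α < φ₀`). In the tree: `δ₀ = ∑ cᵢ kᵢ` (PNT, above); `φ₀ = ∫_Ω dψ` for a
Rhin–Viola class-prime product (`…DiophantineApproximation.RhinViola.tendsto_log_classPrimeProduct_div`). -/

/-- Lower exponential bound from a log-rate: `f n > 0`, `log (f n)/n → φ₀`, `φ' < φ₀` give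
`e^{φ' n} ≤ f n` for all large `n`. -/
theorem eventually_exp_mul_le_of_tendsto_log_div {f : ℕ → ℝ} (hf : ∀ n, 0 < f n) {φ₀ φ' : ℝ}
    (h : Tendsto (fun n : ℕ => Real.log (f n) / n) atTop (𝓝 φ₀)) (hφ : φ' < φ₀) :
    ∀ᶠ n : ℕ in atTop, Real.exp (φ' * n) ≤ f n := by
  filter_upwards [h.eventually (Ioi_mem_nhds hφ), eventually_gt_atTop 0] with n hn hn0
  have h1 : φ' * n < Real.log (f n) := (lt_div_iff₀ (by exact_mod_cast hn0)).1 hn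
  simpa [Real.exp_log (hf n)] using (Real.exp_lt_exp.2 h1).le

/-- Upper exponential bound from a log-rate: `f n > 0`, `log (f n)/n → δ₀`, `δ₀ < δ'` give
`f n ≤ e^{δ' n}` for all large `n`. -/
theorem eventually_le_exp_mul_of_tendsto_log_div {f : ℕ → ℝ} (hf : ∀ n, 0 < f n) {δ₀ δ' : ℝ}
    (h : Tendsto (fun n : ℕ => Real.log (f n) / n) atTop (𝓝 δ₀)) (hδ : δ₀ < δ') :
    ∀ᶠ n : ℕ in atTop, f n ≤ Real.exp (δ' * n) := by
  filter_upwards [h.eventually (Iio_mem_nhds hδ), eventually_gt_atTop 0] with n hn hn0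
  have h1 : Real.log (f n) < δ' * n := (div_lt_iff₀ (by exact_mod_cast hn0)).1 hn
  simpa [Real.exp_log (hf n)] using (Real.exp_lt_exp.2 h1).le

/-- Decay bound from a root-rate: `|ℓ n|^{1/n} → α > 0` and `c' < -log α` give
`|ℓ n| ≤ e^{-c' n}` for all large `n`. -/
theorem eventually_abs_le_exp_of_tendsto_root {ℓ : ℕ → ℝ} {α c' : ℝ} (hα : 0 < α)
    (h : Tendsto (fun n : ℕ => |ℓ n| ^ (1 / (n : ℝ))) atTop (𝓝 α)) (hc : c' < -Real.log α) :
    ∀ᶠ n : ℕ in atTop, |ℓ n| ≤ Real.exp (-(c' * n)) := by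
  have ha : α < Real.exp (-c') := by rw [← Real.exp_log hα]; exact Real.exp_lt_exp.2 (by linarith)
  filter_upwards [h.eventually (Iio_mem_nhds ha), eventually_gt_atTop 0] with n hn hn0
  have key : (|ℓ n| ^ (1 / (n : ℝ))) ^ n = |ℓ n| := by
    rw [one_div, Real.rpow_inv_natCast_pow (abs_nonneg _) hn0.ne']
  have h1 : (|ℓ n| ^ (1 / (n : ℝ))) ^ n ≤ (Real.exp (-c')) ^ n :=
    pow_le_pow_left₀ (Real.rpow_nonneg (abs_nonneg _) _) hn.le n
  rw [key, ← Real.exp_nat_mul] at h1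
  convert h1 using 2; ring

/-- **Criterion C1 on RATES.** `D n ℓ n = Φ n (a n + b n ξ)` for large `n` (`a n, b n ∈ ℤ`,
`D n, Φ n ∈ ℕ⁺`), `|ℓ n|^{1/n} → α > 0`, `log D n / n → δ₀`, `log Φ n / n → φ₀`, `ℓ n ≠ 0`
infinitely often, and `δ₀ + log α < φ₀` (`μ₁ = -log α + φ₀ - δ₀ > 0`): then `ξ ∉ ℚ`. -/
theorem irrational_of_rates {ξ : ℝ} (ℓ : ℕ → ℝ) (D Φ : ℕ → ℕ) (a b : ℕ → ℤ)
    (hD : ∀ n, 0 < D n) (hΦ : ∀ n, 0 < Φ n)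
    (harith : ∀ᶠ n : ℕ in atTop, (D n : ℝ) * ℓ n = Φ n * (a n + b n * ξ))
    {α δ₀ φ₀ : ℝ} (hα : 0 < α)
    (hℓ : Tendsto (fun n : ℕ => |ℓ n| ^ (1 / (n : ℝ))) atTop (𝓝 α))
    (hDrate : Tendsto (fun n : ℕ => Real.log (D n) / n) atTop (𝓝 δ₀))
    (hΦrate : Tendsto (fun n : ℕ => Real.log (Φ n) / n) atTop (𝓝 φ₀))
    (hne : ∃ᶠ n : ℕ in atTop, ℓ n ≠ 0) (hmargin : δ₀ + Real.log α < φ₀) : Irrational ξ := by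
  set ε : ℝ := (φ₀ - δ₀ - Real.log α) / 4 with hε
  exact LinearFormCertificate.irrational (ξ := ξ)
    { form := ℓ, denom := D, saving := Φ, coeffConst := a, coeffXi := b,
      decayRate := -Real.log α - ε, denomRate := δ₀ + ε, savingRate := φ₀ - ε,
      denom_pos := hD, saving_pos := hΦ, arith := harith, nonvanishing := hne,
      decay := eventually_abs_le_exp_of_tendsto_root hα hℓ (by rw [hε]; linarith)
      denom_le := eventually_le_exp_mul_of_tendsto_log_div
        (fun n => by exact_mod_cast hD n) hDrate (by rw [hε]; linarith)
      le_saving := eventually_exp_mul_le_of_tendsto_log_div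
        (fun n => by exact_mod_cast hΦ n) hΦrate (by rw [hε]; linarith)
      margin_pos := by rw [hε]; linarith }

end Summit.KontsevichZagierPeriods.Zeta5Search
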